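import Literature.NumberTheory.Automorphic.Liu2021.LemD1AsPrintedIndexedNonVacuityCharacterDecisionAllRanks
import Literature.NumberTheory.Automorphic.Liu2021.LemD1AsPrintedIndexedNonVacuityDetCarrier
import Literature.NumberTheory.Automorphic.UnitaryIsotropicAbelianization
import HarnessLib

/-!
# [Liu2021, App. D Lemma D.1 (3)] bookkeeping — EVERY rank `N ≥ 3`, every NON-SPLIT place: `U(V)(F_v)′ = SU(V)(F_v)` and
# `U(V)(F_v) ∕ SU(V)(F_v) ≅ E_v¹` via `det`; the characters of `U(V)(F_v)` ARE the characters of `E_v¹` composed with `det`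

Reproduction ∕ bookkeeping (Literature, THEOREMS ONLY: no definition, no record, no named fact, no `sorry`; nothing is
asserted about Liu's oscillator representations or about the tree's constructed local Weil carriers).

✔ `…CharacterDecisionAllRanks` proved, for the place model `S = LemD1OfPlace.standingData` of [Liu2021, App. D §D.1] (`U(V)(F_v) = S.U ≤
GL_N(E_v)`, `E_v = E ⊗_F F_v`, centre `E_v¹ = S.normOne`), that every character `S.U →* ℂˣ` kills `{det = 1}` at a non-split place
(`N ≥ 3`).  With the abelianization theorem now in the tree (✔ `Automorphic/UnitaryIsotropicAbelianization`: `commutator U(J) = ker det`,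
[Dieudonne1971GroupesClassiques, Chap. II §5]) THIS FILE states the structure behind it, for homomorphisms to ANY commutative group `A`:

* §0 (private, pure group theory) a «kills `{f = 1}`» property for the canonical map `G → G^{ab}` gives `commutator G = ker f`; from
  `commutator G = ker f`: homomorphisms to commutative groups depend on `f` only, factor UNIQUELY through any subgroup `K = f(G)`, and
  `G^{ab} → K` is bijective.
* §1 **`range_det_eq_normOne`** — at EVERY finite place `v`, for EVERY `N ≥ 2` and EVERY hermitian non-degenerate `J`:
  `det(U(V)(F_v)) = E_v¹` as subgroups of `E_vˣ` (`⊆`: `det` of a unitary matrix is norm-one; `⊇`: ✔ `…DetCarrier.exists_mem_U_det_eq`).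
* §2 ANY quadratic `E/F`, DIAGONAL `J` of rank `N ≥ 3`, NON-SPLIT `w ∣ v`: **`commutator_U_eq_ker_det_of_diagonal`** (`U(V)(F_v)′ = SU(V)(F_v)`),
  **`mem_commutator_U_iff_of_diagonal`**, **`apply_eq_of_det_eq_of_diagonal`** (every `Ψ : U(V)(F_v) →* A` depends on `det` only),
  **`existsUnique_normOne_factor_of_diagonal`** (`Ψ = ψ ∘ det` for a UNIQUE `ψ : E_v¹ →* A`: the characters of `U(V)(F_v)` ARE the characters
  of `E_v¹`), **`bijective_abelianization_det_of_diagonal`** (`U(V)(F_v)^{ab} ≅ E_v¹`).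
* §3 the CM rows (`L` CM, `F = L⁺`), ANY hermitian non-degenerate `J_N` over `L` (`N ≥ 3`; Landherr congruence to a diagonal form,
  ✔ `UnitaryRankThree.apply_eq_one_of_det_eq_one_of_formCongr`), every non-split place: the same four statements `…_of_isCMField`.

So at a non-split place the one-dimensional representation theory of `U(V)(F_v)` used in the [Lem. D.1 (3)] bookkeeping is EXACTLY that of the
compact torus `E_v¹`: ✔ `…DetLineDecision` ∕ ✔ `…CharacterDecisionAllRanks` are its corollaries for `A = ℂˣ`.

What this does NOT give: SPLIT places (`E_v = F_v × F_v` is not a field, `U(V)(F_v) ≅ GL_N(F_v)`, whose commutator subgroup `SL_N(F_v)` is a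
different theorem); rank `N = 2`; carriers of dimension `> 1`; the rows' OWN carriers `𝓢.omegaLoc v`; Lem. D.1 itself.  HC_CM is NOT proved.

Cell pub-hodgecm2 (COR-CM), audit class of the END rows `hD1''` ∕ `hD3`; seat prover-pub-hodgecm2-b10.

References: [Liu2021] Y. Liu, *Fourier–Jacobi cycles and arithmetic relative trace formula*, Camb. J. Math. 9 (2021) =
arXiv:2102.11518, App. D §D.1 (l. 5213–5221), Lemma D.1 (3) (l. 5233); [Dieudonne1971GroupesClassiques] J. Dieudonné, *La géométrie
des groupes classiques*, 3e éd. (1971), Chap. II §§4–5; [Jacobson1940HermitianForms] N. Jacobson, Bull. AMS 46 (1940), §3 (1)(a);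
[Landherr1936HermitianForms] W. Landherr, Abh. Math. Sem. Hamburg 11 (1936); [Mok2014] C. P. Mok, Mem. AMS 235 (2015), §1 Notation p. 5.
-/

noncomputable section

open scoped Matrix MatrixGroups
open NumberField IsDedekindDomain
open Literature.RepresentationTheory
open Literature.RepresentationTheory.Liu2021 (OscillatorStandingData)
open Literature.NumberTheory.GaloisRepresentations (HeckeCharacter)
open Literature.NumberTheory.QuadraticForms (HermitianLocal.exists_isotropic_localRing_diagonal)

namespace Literature.NumberTheory.Automorphic.Liu2021.LemD1IndexedNonVacuityCharacterDecisionAllRanksAbelianization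

open UnitaryGroup

/-! ## §0 Pure group theory (private): from «`G → G^{ab}` kills `{f = 1}`» to `commutator G = ker f` and its consequences -/

section GroupTheory

variable {G M A : Type*} [Group G] [CommGroup M] [CommGroup A]

/-- If `S = T` as subgroups and every hom on `T` kills the elements satisfying `P`, so does every hom on `S`
(copy of the siblings' private lemma). [folklore] -/
private theorem kills_of_eq {H : Type*} [Group H] {S T : Subgroup H} (e : S = T) (P : H → Prop)
    (hT : ∀ (θ' : ↥T →* A) (y : ↥T), P y.1 → θ' y = 1) (θ : ↥S →* A) (x : ↥S) (hx : P x.1) : θ x = 1 := by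
  subst e
  exact hT θ x hx

/-- `commutator G = ker f` as soon as `ker f` dies in `G^{ab}` (the other inclusion holds because `M` is commutative). [folklore] -/
private theorem commutator_eq_ker_of_kills (f : G →* M)
    (h : ∀ g : G, f g = 1 → (Abelianization.of g : Abelianization G) = 1) : commutator G = f.ker := by
  refine le_antisymm (Abelianization.commutator_subset_ker f) fun g hg => ?_
  have key := h g ((MonoidHom.mem_ker).1 hg)
  rwa [← MonoidHom.mem_ker, Abelianization.ker_of] at key

/-- From `commutator G = ker f`: a homomorphism to a commutative group depends on `f` only. [folklore] -/
private theorem apply_eq_of_commutator_eq (f : G →* M) (hc : commutator G = f.ker) (χ : G →* A) (g h : G)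
    (hgh : f g = f h) : χ g = χ h := by
  have hmem : g * h⁻¹ ∈ χ.ker := by
    refine Abelianization.commutator_subset_ker χ ?_
    rw [hc, MonoidHom.mem_ker, map_mul, map_inv, hgh, mul_inv_cancel]
  rwa [MonoidHom.mem_ker, map_mul, map_inv, mul_inv_eq_one] at hmem

/-- From `commutator G = ker f` and `f(G) = K`: every homomorphism to a commutative group is `ψ ∘ f` for a UNIQUE `ψ : K →* A`.
[folklore] -/
private theorem existsUnique_factor_of_commutator_eq (f : G →* M) (hc : commutator G = f.ker) {K : Subgroup M}
    (hK : f.range = K) (χ : G →* A) : ∃! ψ : ↥K →* A, ∀ (g : G) (hg : f g ∈ K), χ g = ψ ⟨f g, hg⟩ := by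
  subst hK
  have hsurj : Function.Surjective f.rangeRestrict := MonoidHom.rangeRestrict_surjective f
  have hker : f.rangeRestrict.ker ≤ χ.ker := by
    rw [MonoidHom.ker_rangeRestrict, ← hc]
    exact Abelianization.commutator_subset_ker χ
  refine ⟨MonoidHom.liftOfSurjective _ hsurj ⟨χ, hker⟩, fun g hg => ?_, fun ψ hψ => ?_⟩
  · have h := MonoidHom.liftOfRightInverse_comp_apply f.rangeRestrict (Function.surjInv hsurj)
      (Function.rightInverse_surjInv hsurj) ⟨χ, hker⟩ g
    exact h.symm
  · ext y
    obtain ⟨g, rfl⟩ := hsurj y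
    rw [MonoidHom.liftOfRightInverse_comp_apply]
    exact (hψ g ⟨g, rfl⟩).symm

/-- From `commutator G = ker f` and `f(G) ≤ K` with every element of `K` a value of `f`: `G^{ab} → K`, `[g] ↦ f g`, is bijective.
[folklore] -/
private theorem bijective_lift_of_commutator_eq (f : G →* M) (hc : commutator G = f.ker) {K : Subgroup M}
    (hmem : ∀ g, f g ∈ K) (hsurj : ∀ k : ↥K, ∃ g, f g = k) :
    Function.Bijective (Abelianization.lift (f.codRestrict K hmem)) := by
  have hofs : Function.Surjective (Abelianization.of : G →* Abelianization G) :=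
    fun x => QuotientGroup.induction_on x fun g => ⟨g, rfl⟩
  constructor
  · rw [← MonoidHom.ker_eq_bot_iff, eq_bot_iff]
    intro x hx
    obtain ⟨g, rfl⟩ := hofs x
    rw [MonoidHom.mem_ker, Abelianization.lift_apply_of] at hx
    have hg : g ∈ f.ker := by
      rw [MonoidHom.mem_ker]
      have h := congrArg (fun k : ↥K => (k : M)) hx
      simpa only [MonoidHom.codRestrict_apply, OneMemClass.coe_one] using h
    rw [← hc, ← Abelianization.ker_of] at hg
    rw [Subgroup.mem_bot]
    exact (MonoidHom.mem_ker).1 hg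
  · intro k
    obtain ⟨g, hg⟩ := hsurj k
    exact ⟨Abelianization.of g, by rw [Abelianization.lift_apply_of]; exact Subtype.ext hg⟩

end GroupTheory

/-! ## §1 EVERY place, EVERY `N ≥ 2`, EVERY hermitian `J`: `det(U(V)(F_v)) = E_v¹` -/

section EveryPlace

variable {F : Type} (E : Type) [Field F] [NumberField F] [Field E] [NumberField E] [Algebra F E]
  [Algebra.IsQuadraticExtension F E] (v : HeightOneSpectrum (𝓞 F)) (c : E ≃ₐ[F] E)
  {δ : E} (hcδ : c δ = -δ) (hδ : δ ≠ 0)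
  (N : ℕ) (J : Matrix (Fin N) (Fin N) E) (hN : 2 ≤ N) (hJh : (J.map c)ᵀ = J) (hJdet : J.det ≠ 0)

/-- determinants of `U(V)(F_v)` are norm-one; copy of the siblings' private lemma. [cite: Liu2021, App. D §D.1 (l. 5213)] [cite: Mok2014, §1 Notation p. 5] -/
private theorem det_mem_normOne (g : (LemD1OfPlace.standingData E v c N J hcδ hδ hN hJh hJdet).U) :
    Matrix.GeneralLinearGroup.det (g : GL (Fin N) (LocalRing E v)) ∈ (LemD1OfPlace.standingData E v c N J hcδ hδ hN hJh hJdet).normOne := by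
  let S := LemD1OfPlace.standingData E v c N J hcδ hδ hN hJh hJdet
  rw [OscillatorStandingData.mem_normOne_iff', Matrix.GeneralLinearGroup.val_det_apply]
  have hg := (OscillatorStandingData.mem_U_iff S _).1 g.2
  have h := congrArg Matrix.det hg
  rw [Matrix.det_mul, Matrix.det_mul, Matrix.det_transpose] at h
  have hc : (((g : GL (Fin N) (LocalRing E v)) : Matrix (Fin N) (Fin N) (LocalRing E v)).map S.conj).det =
      S.conj (((g : GL (Fin N) (LocalRing E v)) : Matrix (Fin N) (Fin N) (LocalRing E v)).det) := by
    rw [AlgEquiv.map_det, AlgEquiv.mapMatrix_apply]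
  rw [hc] at h
  have h2 : (((g : GL (Fin N) (LocalRing E v)) : Matrix (Fin N) (Fin N) (LocalRing E v)).det *
      S.conj (((g : GL (Fin N) (LocalRing E v)) : Matrix (Fin N) (Fin N) (LocalRing E v)).det) - 1) * S.gram.det = 0 := by
    linear_combination h
  exact sub_eq_zero.1 ((S.isUnit_det_gram.mul_left_eq_zero).1 h2)

include hcδ in
/-- **`det(U(V)(F_v)) = E_v¹`** at EVERY finite place `v` of `F`, for EVERY rank `N ≥ 2` and EVERY hermitian non-degenerate `J`: the range
of `det : S.U →* E_vˣ` IS the norm-one subgroup `S.normOne` (`⊆`: determinants of unitary matrices are norm-one; `⊇`: the dilations of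
✔ `…DetCarrier.exists_mem_U_det_eq`). [cite: Liu2021, App. D §D.1 (l. 5213)] [cite: Mok2014, §1 Notation p. 5] [cite: Dieudonne1971GroupesClassiques, Chap. II §5] -/
theorem range_det_eq_normOne :
    (Matrix.GeneralLinearGroup.det.comp (LemD1OfPlace.standingData E v c N J hcδ hδ hN hJh hJdet).U.subtype).range =
      (LemD1OfPlace.standingData E v c N J hcδ hδ hN hJh hJdet).normOne := by
  ext z
  constructor
  · rintro ⟨g, rfl⟩
    rw [MonoidHom.comp_apply, Subgroup.subtype_apply]
    exact det_mem_normOne E v c hcδ hδ N J hN hJh hJdet g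
  · intro hz
    obtain ⟨g, hg⟩ := LemD1IndexedNonVacuityDetCarrier.exists_mem_U_det_eq E v c hcδ hδ N J hN hJh hJdet ⟨z, hz⟩
    exact ⟨g, by rw [MonoidHom.comp_apply, Subgroup.subtype_apply]; exact hg⟩

include hcδ in
/-- Pointwise form (the membership hypothesis `hmem` of the `bijective_abelianization_det_…` theorems below): `det g ∈ E_v¹` for every
`g ∈ U(V)(F_v)` — every place, every `N ≥ 2`. [cite: Liu2021, App. D §D.1 (l. 5213)] [cite: Mok2014, §1 Notation p. 5] -/
theorem det_comp_subtype_mem_normOne (g : (LemD1OfPlace.standingData E v c N J hcδ hδ hN hJh hJdet).U) :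
    (Matrix.GeneralLinearGroup.det.comp (LemD1OfPlace.standingData E v c N J hcδ hδ hN hJh hJdet).U.subtype) g ∈
      (LemD1OfPlace.standingData E v c N J hcδ hδ hN hJh hJdet).normOne := by
  rw [MonoidHom.comp_apply, Subgroup.subtype_apply]
  exact det_mem_normOne E v c hcδ hδ N J hN hJh hJdet g

end EveryPlace

/-! ## §2 ANY quadratic `E/F`, DIAGONAL `J` of rank `N ≥ 3`, NON-SPLIT place: `U(V)(F_v)′ = SU(V)(F_v)`, characters = characters of `E_v¹` -/

section Diagonal

variable {F : Type} (E : Type) [Field F] [NumberField F] [Field E] [NumberField E] [Algebra F E]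
  [Algebra.IsQuadraticExtension F E] (v : HeightOneSpectrum (𝓞 F)) (c : E ≃ₐ[F] E)
  {δ : E} (hcδ : c δ = -δ) (hδ : δ ≠ 0) {N : ℕ} (hN : 2 ≤ N) (hN3 : 3 ≤ N)
  (d : Fin N → E) (hJh : ((Matrix.diagonal d).map c)ᵀ = Matrix.diagonal d) (hJdet : (Matrix.diagonal d).det ≠ 0)

omit [NumberField F] [Algebra.IsQuadraticExtension F E] in
include hcδ hδ in
/-- `c ≠ 1` (`c δ = −δ ≠ δ`); copy of the siblings' private lemma. [folklore] -/
private theorem hc_of_delta : c ≠ 1 := by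
  rintro rfl
  rw [AlgEquiv.one_apply] at hcδ
  have h2 : (2 : E) * δ = 0 := by linear_combination hcδ
  exact hδ ((mul_eq_zero.mp h2).resolve_left two_ne_zero)

omit [NumberField F] [NumberField E] [Algebra.IsQuadraticExtension F E] in
include hJh in
/-- the diagonal entries of a hermitian diagonal matrix are `c`-fixed; copy of the siblings' private lemma. [folklore] -/
private theorem apply_diag_eq (i : Fin N) : c (d i) = d i := by
  have h := congrFun (congrFun hJh i) i
  rwa [Matrix.transpose_apply, Matrix.map_apply, Matrix.diagonal_apply_eq] at h

omit [NumberField F] [NumberField E] [Algebra.IsQuadraticExtension F E] [Algebra F E] in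
include hJdet in
/-- the diagonal entries of a non-degenerate diagonal matrix are non-zero; copy of the siblings' private lemma. [folklore] -/
private theorem diag_ne_zero (i : Fin N) : d i ≠ 0 := by
  rw [Matrix.det_diagonal] at hJdet
  exact (Finset.prod_ne_zero_iff.1 hJdet) i (Finset.mem_univ i)

include hcδ hJh hJdet hN3 in
/-- rank `N ≥ 3`, diagonal `J`, non-split place: every homomorphism `S.U →* A` to ANY commutative group kills `{det = 1}` (the proof of
✔ `…CharacterDecisionAllRanks.apply_eq_one_of_det_eq_one_of_diagonal`, verbatim with `ℂˣ ↦ A`). [cite: Dieudonne1971GroupesClassiques, Chap. II §5]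
[cite: Jacobson1940HermitianForms, §3 (1)(a)] -/
private theorem kills_of_diagonal {A : Type*} [CommGroup A] (w : PlacesOver E v) (hw : c • w.1 = w.1)
    (Ψ : (LemD1OfPlace.standingData E v c N (Matrix.diagonal d) hcδ hδ hN hJh hJdet).U →* A)
    (g : (LemD1OfPlace.standingData E v c N (Matrix.diagonal d) hcδ hδ hN hJh hJdet).U)
    (hg : Matrix.GeneralLinearGroup.det (g : GL (Fin N) (LocalRing E v)) = 1) : Ψ g = 1 := by
  classical
  have hc : c ≠ 1 := hc_of_delta E c hcδ hδ
  have hd : ∀ i, c (d i) = d i := apply_diag_eq E c d hJh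
  have hd0 : ∀ i, d i ≠ 0 := diag_ne_zero E d hJdet
  letI : Field (LocalRing E v) := (LocalRing.isField_of_smul_eq c hc w hw).toField
  have hσ : ∀ x, conjLocal E c v (conjLocal E c v x) = x := LemD1OfPlace.conjLocal_conjLocal_apply E v c hcδ hδ
  have hθ : conjLocal E c v (algebraMap E (LocalRing E v) δ) = -algebraMap E (LocalRing E v) δ := by
    rw [conjLocal_algebraMap, hcδ, map_neg]
  have hθ0 : algebraMap E (LocalRing E v) δ ≠ 0 := (_root_.map_ne_zero _).2 hδ
  have h2 : (2 : LocalRing E v) ≠ 0 := by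
    rw [← map_ofNat (algebraMap E (LocalRing E v)) 2]
    exact (_root_.map_ne_zero _).2 two_ne_zero
  have hEq : (LemD1OfPlace.standingData E v c N (Matrix.diagonal d) hcδ hδ hN hJh hJdet).U =
      unitaryGroupOfForm (conjLocal E c v) ((adelicForm E N (Matrix.diagonal d)).map (adeleToLocal E v)) :=
    Subgroup.ext fun x => LemD1OfPlace.mem_U_iff E v c N (Matrix.diagonal d) hcδ hδ hN hJh hJdet x
  have hM : (adelicForm E N (Matrix.diagonal d)).map (adeleToLocal E v) =
      Matrix.diagonal (fun i => algebraMap E (LocalRing E v) (d i)) := by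
    rw [LemD1OfPlace.localGram_eq, Matrix.diagonal_map (map_zero _)]
  have hJh' : ((Matrix.diagonal (fun i => algebraMap E (LocalRing E v) (d i))).map (conjLocal E c v)).transpose =
      Matrix.diagonal (fun i => algebraMap E (LocalRing E v) (d i)) := by
    rw [Matrix.diagonal_map (map_zero _), Matrix.diagonal_transpose]
    congr 1
    funext i
    rw [conjLocal_algebraMap, hd]
  have hJdet' : (Matrix.diagonal (fun i => algebraMap E (LocalRing E v) (d i))).det ≠ 0 := by
    rw [Matrix.det_diagonal]
    exact Finset.prod_ne_zero_iff.2 fun i _ => (_root_.map_ne_zero _).2 (hd0 i)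
  obtain ⟨x, hx0, hxx⟩ := HermitianLocal.exists_isotropic_localRing_diagonal E c hc v hN3 hd
  rw [Matrix.diagonal_map (map_zero _)] at hxx
  refine kills_of_eq hEq (fun y => ((y : GL (Fin N) (LocalRing E v)) : Matrix (Fin N) (Fin N) (LocalRing E v)).det = 1)
    ?_ Ψ g ?_
  · intro θ' y hy
    exact UnitaryIsotropic.apply_eq_one_of_det_eq_one' (σ := conjLocal E c v) hσ hθ hθ0 h2 _
      (Matrix.diagonal (fun i => algebraMap E (LocalRing E v) (d i))) hM hJh' hJdet' ⟨x, hx0, hxx⟩ θ' y hy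
  · have h := congrArg (fun u : (LocalRing E v)ˣ => (u : LocalRing E v)) hg
    simpa only [Matrix.GeneralLinearGroup.val_det_apply, Units.val_one] using h

include hN3 in
/-- **`U(V)(F_v)′ = SU(V)(F_v)`** — ANY quadratic `E/F`, diagonal `J` of rank `N ≥ 3`, NON-SPLIT `w ∣ v`: the commutator subgroup of
`U(V)(F_v) = S.U` is the kernel of `det : S.U →* E_vˣ`. [cite: Dieudonne1971GroupesClassiques, Chap. II §5] [cite: Jacobson1940HermitianForms, §3 (1)(a)]
[cite: Liu2021, App. D §D.1 Step 3 (l. 5221)] -/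
theorem commutator_U_eq_ker_det_of_diagonal (w : PlacesOver E v) (hw : c • w.1 = w.1) :
    commutator ↥(LemD1OfPlace.standingData E v c N (Matrix.diagonal d) hcδ hδ hN hJh hJdet).U =
      (Matrix.GeneralLinearGroup.det.comp (LemD1OfPlace.standingData E v c N (Matrix.diagonal d) hcδ hδ hN hJh hJdet).U.subtype).ker :=
  commutator_eq_ker_of_kills _ fun g hg =>
    kills_of_diagonal E v c hcδ hδ hN hN3 d hJh hJdet w hw Abelianization.of g
      (by rw [MonoidHom.comp_apply, Subgroup.subtype_apply] at hg; exact hg)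

include hN3 in
/-- **Membership form: `g ∈ U(V)(F_v)′ ↔ det g = 1`** (diagonal `J`, `N ≥ 3`, non-split place). [cite: Dieudonne1971GroupesClassiques, Chap. II §5]
[cite: Liu2021, App. D §D.1 Step 3 (l. 5221)] -/
theorem mem_commutator_U_iff_of_diagonal (w : PlacesOver E v) (hw : c • w.1 = w.1)
    (g : (LemD1OfPlace.standingData E v c N (Matrix.diagonal d) hcδ hδ hN hJh hJdet).U) :
    g ∈ commutator ↥(LemD1OfPlace.standingData E v c N (Matrix.diagonal d) hcδ hδ hN hJh hJdet).U ↔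
      Matrix.GeneralLinearGroup.det (g : GL (Fin N) (LocalRing E v)) = 1 := by
  rw [commutator_U_eq_ker_det_of_diagonal E v c hcδ hδ hN hN3 d hJh hJdet w hw, MonoidHom.mem_ker, MonoidHom.comp_apply,
    Subgroup.subtype_apply]

include hN3 in
/-- **Every homomorphism `U(V)(F_v) →* A` to a commutative group depends on `det` only** (diagonal `J`, `N ≥ 3`, non-split place):
`det g = det h ⟹ Ψ g = Ψ h`. [cite: Dieudonne1971GroupesClassiques, Chap. II §5] [cite: Liu2021, App. D §D.1 Step 3 (l. 5221)] -/
theorem apply_eq_of_det_eq_of_diagonal {A : Type*} [CommGroup A] (w : PlacesOver E v) (hw : c • w.1 = w.1)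
    (Ψ : (LemD1OfPlace.standingData E v c N (Matrix.diagonal d) hcδ hδ hN hJh hJdet).U →* A)
    (g h : (LemD1OfPlace.standingData E v c N (Matrix.diagonal d) hcδ hδ hN hJh hJdet).U)
    (hgh : Matrix.GeneralLinearGroup.det (g : GL (Fin N) (LocalRing E v)) = Matrix.GeneralLinearGroup.det (h : GL (Fin N) (LocalRing E v))) :
    Ψ g = Ψ h :=
  apply_eq_of_commutator_eq _ (commutator_U_eq_ker_det_of_diagonal E v c hcδ hδ hN hN3 d hJh hJdet w hw) Ψ g h
    (by rw [MonoidHom.comp_apply, MonoidHom.comp_apply, Subgroup.subtype_apply, Subgroup.subtype_apply]; exact hgh)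

include hN3 in
/-- **The characters of `U(V)(F_v)` ARE the characters of `E_v¹`** (diagonal `J`, `N ≥ 3`, non-split place; any commutative target `A`): every
homomorphism `Ψ : S.U →* A` is `ψ ∘ det` for a UNIQUE homomorphism `ψ : S.normOne →* A` (`det : S.U ↠ S.normOne` by §1).
[cite: Dieudonne1971GroupesClassiques, Chap. II §5] [cite: Liu2021, App. D §D.1 Step 3 (l. 5221) and Lemma D.1 (3) (l. 5233)] -/
theorem existsUnique_normOne_factor_of_diagonal {A : Type*} [CommGroup A] (w : PlacesOver E v) (hw : c • w.1 = w.1)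
    (Ψ : (LemD1OfPlace.standingData E v c N (Matrix.diagonal d) hcδ hδ hN hJh hJdet).U →* A) :
    ∃! ψ : ↥(LemD1OfPlace.standingData E v c N (Matrix.diagonal d) hcδ hδ hN hJh hJdet).normOne →* A,
      ∀ (g : (LemD1OfPlace.standingData E v c N (Matrix.diagonal d) hcδ hδ hN hJh hJdet).U)
        (hg : Matrix.GeneralLinearGroup.det (g : GL (Fin N) (LocalRing E v)) ∈
          (LemD1OfPlace.standingData E v c N (Matrix.diagonal d) hcδ hδ hN hJh hJdet).normOne),
        Ψ g = ψ ⟨Matrix.GeneralLinearGroup.det (g : GL (Fin N) (LocalRing E v)), hg⟩ := by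
  have h := existsUnique_factor_of_commutator_eq _ (commutator_U_eq_ker_det_of_diagonal E v c hcδ hδ hN hN3 d hJh hJdet w hw)
    (range_det_eq_normOne E v c hcδ hδ N (Matrix.diagonal d) hN hJh hJdet) Ψ
  simpa only [MonoidHom.comp_apply, Subgroup.subtype_apply] using h

include hN3 in
/-- **`U(V)(F_v)^{ab} ≅ E_v¹`** (diagonal `J`, `N ≥ 3`, non-split place): the homomorphism `S.U^{ab} → S.normOne`, `[g] ↦ det g`, is BIJECTIVE.
[cite: Dieudonne1971GroupesClassiques, Chap. II §5] [cite: Liu2021, App. D §D.1 Step 3 (l. 5221)] -/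
theorem bijective_abelianization_det_of_diagonal (w : PlacesOver E v) (hw : c • w.1 = w.1)
    (hmem : ∀ g : (LemD1OfPlace.standingData E v c N (Matrix.diagonal d) hcδ hδ hN hJh hJdet).U,
      (Matrix.GeneralLinearGroup.det.comp (LemD1OfPlace.standingData E v c N (Matrix.diagonal d) hcδ hδ hN hJh hJdet).U.subtype) g ∈
        (LemD1OfPlace.standingData E v c N (Matrix.diagonal d) hcδ hδ hN hJh hJdet).normOne) :
    Function.Bijective (Abelianization.lift
      ((Matrix.GeneralLinearGroup.det.comp (LemD1OfPlace.standingData E v c N (Matrix.diagonal d) hcδ hδ hN hJh hJdet).U.subtype).codRestrict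
        (LemD1OfPlace.standingData E v c N (Matrix.diagonal d) hcδ hδ hN hJh hJdet).normOne hmem)) :=
  bijective_lift_of_commutator_eq _ (commutator_U_eq_ker_det_of_diagonal E v c hcδ hδ hN hN3 d hJh hJdet w hw) hmem fun k => by
    obtain ⟨g, hg⟩ := LemD1IndexedNonVacuityDetCarrier.exists_mem_U_det_eq E v c hcδ hδ N (Matrix.diagonal d) hN hJh hJdet k
    exact ⟨g, by rw [MonoidHom.comp_apply, Subgroup.subtype_apply]; exact hg⟩

end Diagonal

/-! ## §3 The CM rows: ANY hermitian `J_N` over `L` (Landherr congruence), every non-split place of `L⁺`, rank `N ≥ 3` -/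

section CM

open Literature.NumberTheory.GelbartRogawski1991.UnitaryDualPair (imagUnit complexConj_imagUnit imagUnit_ne_zero)
open Literature.NumberTheory.QuadraticForms (Landherr.conjTranspose Landherr.conjTranspose_apply Landherr.exists_congr_diagonal)

variable (L : Type) [Field L] [NumberField L] [IsCMField L]

local notation3 "cc" => (IsCMField.complexConj L)
local notation3 "L⁺" => (↥(maximalRealSubfield L))

variable (v : HeightOneSpectrum (𝓞 (maximalRealSubfield L))) {N : ℕ} (hN : 2 ≤ N) (hN3 : 3 ≤ N)
  (J : Matrix (Fin N) (Fin N) L) (hJh : (J.map (IsCMField.complexConj L))ᵀ = J) (hJdet : J.det ≠ 0)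

include hN3 in
/-- CM rows, any hermitian `J_N` (`N ≥ 3`), non-split place: every homomorphism `S.U →* A` to ANY commutative group kills `{det = 1}` (the proof
of ✔ `…CharacterDecisionAllRanks.apply_eq_one_of_det_eq_one_of_isCMField`, verbatim with `ℂˣ ↦ A`: Landherr's congruence over `L`, read in
the field `L ⊗ L⁺_v`, transports the engine on the diagonal form). [cite: Dieudonne1971GroupesClassiques, Chap. II §5] [cite: Landherr1936HermitianForms]
[cite: Jacobson1940HermitianForms, §3 (1)(a)] -/
private theorem kills_of_isCMField {A : Type*} [CommGroup A] (w : PlacesOver L v) (hw : cc • w.1 = w.1)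
    (Ψ : (LemD1OfPlace.standingData L v cc N J (complexConj_imagUnit L) (imagUnit_ne_zero L) hN hJh hJdet).U →* A)
    (g : (LemD1OfPlace.standingData L v cc N J (complexConj_imagUnit L) (imagUnit_ne_zero L) hN hJh hJdet).U)
    (hg : Matrix.GeneralLinearGroup.det (g : GL (Fin N) (LocalRing L v)) = 1) : Ψ g = 1 := by
  classical
  have hc : cc ≠ 1 := IsCMField.complexConj_ne_one L
  have hσ : ∀ x, conjLocal L cc v (conjLocal L cc v x) = x :=
    LemD1OfPlace.conjLocal_conjLocal_apply L v cc (complexConj_imagUnit L) (imagUnit_ne_zero L)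
  have hθ : conjLocal L cc v (algebraMap L (LocalRing L v) (imagUnit L)) = -algebraMap L (LocalRing L v) (imagUnit L) := by
    rw [conjLocal_algebraMap, complexConj_imagUnit L, map_neg]
  have hθ0 : algebraMap L (LocalRing L v) (imagUnit L) ≠ 0 := (_root_.map_ne_zero _).2 (imagUnit_ne_zero L)
  have h2 : (2 : LocalRing L v) ≠ 0 := by
    rw [← map_ofNat (algebraMap L (LocalRing L v)) 2]
    exact (_root_.map_ne_zero _).2 two_ne_zero
  have hcomp : ∀ y : L, conjLocal L cc v (algebraMap L (LocalRing L v) y) = algebraMap L (LocalRing L v) (IsCMField.complexConj L y) :=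
    fun y => conjLocal_algebraMap cc v y
  -- Landherr's congruence over `L`
  have hJh' : Landherr.conjTranspose L J = J := by
    change (Jᵀ).map (IsCMField.complexConj L) = J
    rw [Matrix.transpose_map]
    exact hJh
  obtain ⟨G, hG, d, hd, hd0, hcong⟩ := Landherr.exists_congr_diagonal L J hJh' hJdet
  -- read in `K = L ⊗ L⁺_v`
  have hGφ : IsUnit (G.map (algebraMap L (LocalRing L v))) := by
    rw [Matrix.isUnit_iff_isUnit_det, ← RingHom.mapMatrix_apply, ← RingHom.map_det]
    exact hG.map _
  let T : GL (Fin N) (LocalRing L v) := hGφ.unit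
  have hT : T.1 = G.map (algebraMap L (LocalRing L v)) := hGφ.unit_spec
  have hM : (adelicForm L N J).map (adeleToLocal L v) = J.map (algebraMap L (LocalRing L v)) :=
    LemD1OfPlace.localGram_eq L v N J
  have hA : (T.1.map (conjLocal L cc v))ᵀ = (Landherr.conjTranspose L G).map (algebraMap L (LocalRing L v)) := by
    rw [hT]
    ext i j
    simp only [Matrix.transpose_apply, Matrix.map_apply, Landherr.conjTranspose_apply, hcomp]
  have hcongr : formCongr (conjLocal L cc v) T ((adelicForm L N J).map (adeleToLocal L v)) =
      Matrix.diagonal (fun i => algebraMap L (LocalRing L v) (d i)) := by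
    change (T.1.map (conjLocal L cc v))ᵀ * _ * T.1 = _
    rw [hA, hM, hT, ← Matrix.map_mul, ← Matrix.map_mul, hcong, Matrix.diagonal_map (map_zero _)]
  -- `S.U` is the tree's local unitary group of `J ⊗ 1`
  have hEq : (LemD1OfPlace.standingData L v cc N J (complexConj_imagUnit L) (imagUnit_ne_zero L) hN hJh hJdet).U =
      unitaryGroupOfForm (conjLocal L cc v) ((adelicForm L N J).map (adeleToLocal L v)) :=
    Subgroup.ext fun x => LemD1OfPlace.mem_U_iff L v cc N J (complexConj_imagUnit L) (imagUnit_ne_zero L) hN hJh hJdet x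
  -- the local diagonal form is hermitian, non-degenerate and isotropic (in the FIELD `L ⊗ L⁺_v`)
  obtain ⟨x, hx0, hxx⟩ := HermitianLocal.exists_isotropic_localRing_diagonal L cc hc v hN3 hd
  rw [Matrix.diagonal_map (map_zero _)] at hxx
  letI : Field (LocalRing L v) := (LocalRing.isField_of_smul_eq cc hc w hw).toField
  have hdJh : ((Matrix.diagonal (fun i => algebraMap L (LocalRing L v) (d i))).map (conjLocal L cc v)).transpose =
      Matrix.diagonal (fun i => algebraMap L (LocalRing L v) (d i)) := by
    rw [Matrix.diagonal_map (map_zero _), Matrix.diagonal_transpose]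
    congr 1
    funext i
    rw [hcomp, hd]
  have hdJdet : (Matrix.diagonal (fun i => algebraMap L (LocalRing L v) (d i))).det ≠ 0 := by
    rw [Matrix.det_diagonal]
    exact Finset.prod_ne_zero_iff.2 fun i _ => (_root_.map_ne_zero _).2 (hd0 i)
  refine kills_of_eq hEq (fun y => ((y : GL (Fin N) (LocalRing L v)) : Matrix (Fin N) (Fin N) (LocalRing L v)).det = 1) ?_ Ψ g ?_
  · intro θ' y hy
    refine UnitaryRankThree.apply_eq_one_of_det_eq_one_of_formCongr T _ _ hcongr (fun χ' g' h' => ?_) θ' y hy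
    exact UnitaryIsotropic.apply_eq_one_of_det_eq_one (σ := conjLocal L cc v) hσ hθ hθ0 h2
      (Matrix.diagonal (fun i => algebraMap L (LocalRing L v) (d i))) hdJh hdJdet ⟨x, hx0, hxx⟩ χ' g' h'
  · have h := congrArg (fun u : (LocalRing L v)ˣ => (u : LocalRing L v)) hg
    simpa only [Matrix.GeneralLinearGroup.val_det_apply, Units.val_one] using h

include hN3 in
/-- **`U(V)(L⁺_v)′ = SU(V)(L⁺_v)`** — CM rows, ANY hermitian non-degenerate `J_N` (`N ≥ 3`), NON-SPLIT `w ∣ v`: the commutator subgroup of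
`S.U` is the kernel of `det`. [cite: Dieudonne1971GroupesClassiques, Chap. II §5] [cite: Landherr1936HermitianForms] [cite: Liu2021, App. D §D.1 Step 3 (l. 5221)] -/
theorem commutator_U_eq_ker_det_of_isCMField (w : PlacesOver L v) (hw : cc • w.1 = w.1) :
    commutator ↥(LemD1OfPlace.standingData L v cc N J (complexConj_imagUnit L) (imagUnit_ne_zero L) hN hJh hJdet).U =
      (Matrix.GeneralLinearGroup.det.comp
        (LemD1OfPlace.standingData L v cc N J (complexConj_imagUnit L) (imagUnit_ne_zero L) hN hJh hJdet).U.subtype).ker :=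
  commutator_eq_ker_of_kills _ fun g hg =>
    kills_of_isCMField L v hN hN3 J hJh hJdet w hw Abelianization.of g
      (by rw [MonoidHom.comp_apply, Subgroup.subtype_apply] at hg; exact hg)

include hN3 in
/-- **Membership form: `g ∈ U(V)(L⁺_v)′ ↔ det g = 1`** (CM rows, any `J_N`, `N ≥ 3`, non-split place).
[cite: Dieudonne1971GroupesClassiques, Chap. II §5] [cite: Liu2021, App. D §D.1 Step 3 (l. 5221)] -/
theorem mem_commutator_U_iff_of_isCMField (w : PlacesOver L v) (hw : cc • w.1 = w.1)
    (g : (LemD1OfPlace.standingData L v cc N J (complexConj_imagUnit L) (imagUnit_ne_zero L) hN hJh hJdet).U) :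
    g ∈ commutator ↥(LemD1OfPlace.standingData L v cc N J (complexConj_imagUnit L) (imagUnit_ne_zero L) hN hJh hJdet).U ↔
      Matrix.GeneralLinearGroup.det (g : GL (Fin N) (LocalRing L v)) = 1 := by
  rw [commutator_U_eq_ker_det_of_isCMField L v hN hN3 J hJh hJdet w hw, MonoidHom.mem_ker, MonoidHom.comp_apply,
    Subgroup.subtype_apply]

include hN3 in
/-- **Every homomorphism `U(V)(L⁺_v) →* A` to a commutative group depends on `det` only** (CM rows, any `J_N`, `N ≥ 3`, non-split place).
[cite: Dieudonne1971GroupesClassiques, Chap. II §5] [cite: Liu2021, App. D §D.1 Step 3 (l. 5221)] -/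
theorem apply_eq_of_det_eq_of_isCMField {A : Type*} [CommGroup A] (w : PlacesOver L v) (hw : cc • w.1 = w.1)
    (Ψ : (LemD1OfPlace.standingData L v cc N J (complexConj_imagUnit L) (imagUnit_ne_zero L) hN hJh hJdet).U →* A)
    (g h : (LemD1OfPlace.standingData L v cc N J (complexConj_imagUnit L) (imagUnit_ne_zero L) hN hJh hJdet).U)
    (hgh : Matrix.GeneralLinearGroup.det (g : GL (Fin N) (LocalRing L v)) = Matrix.GeneralLinearGroup.det (h : GL (Fin N) (LocalRing L v))) :
    Ψ g = Ψ h :=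
  apply_eq_of_commutator_eq _ (commutator_U_eq_ker_det_of_isCMField L v hN hN3 J hJh hJdet w hw) Ψ g h
    (by rw [MonoidHom.comp_apply, MonoidHom.comp_apply, Subgroup.subtype_apply, Subgroup.subtype_apply]; exact hgh)

include hN3 in
/-- **The characters of `U(V)(L⁺_v)` ARE the characters of `L_v¹`** (CM rows, any `J_N`, `N ≥ 3`, non-split place; any commutative `A`): every
`Ψ : S.U →* A` is `ψ ∘ det` for a UNIQUE `ψ : S.normOne →* A`. [cite: Dieudonne1971GroupesClassiques, Chap. II §5]
[cite: Liu2021, App. D §D.1 Step 3 (l. 5221) and Lemma D.1 (3) (l. 5233)] -/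
theorem existsUnique_normOne_factor_of_isCMField {A : Type*} [CommGroup A] (w : PlacesOver L v) (hw : cc • w.1 = w.1)
    (Ψ : (LemD1OfPlace.standingData L v cc N J (complexConj_imagUnit L) (imagUnit_ne_zero L) hN hJh hJdet).U →* A) :
    ∃! ψ : ↥(LemD1OfPlace.standingData L v cc N J (complexConj_imagUnit L) (imagUnit_ne_zero L) hN hJh hJdet).normOne →* A,
      ∀ (g : (LemD1OfPlace.standingData L v cc N J (complexConj_imagUnit L) (imagUnit_ne_zero L) hN hJh hJdet).U)
        (hg : Matrix.GeneralLinearGroup.det (g : GL (Fin N) (LocalRing L v)) ∈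
          (LemD1OfPlace.standingData L v cc N J (complexConj_imagUnit L) (imagUnit_ne_zero L) hN hJh hJdet).normOne),
        Ψ g = ψ ⟨Matrix.GeneralLinearGroup.det (g : GL (Fin N) (LocalRing L v)), hg⟩ := by
  have h := existsUnique_factor_of_commutator_eq _ (commutator_U_eq_ker_det_of_isCMField L v hN hN3 J hJh hJdet w hw)
    (range_det_eq_normOne L v cc (complexConj_imagUnit L) (imagUnit_ne_zero L) N J hN hJh hJdet) Ψ
  simpa only [MonoidHom.comp_apply, Subgroup.subtype_apply] using h

include hN3 in
/-- **`U(V)(L⁺_v)^{ab} ≅ L_v¹`** (CM rows, any `J_N`, `N ≥ 3`, non-split place): `S.U^{ab} → S.normOne`, `[g] ↦ det g`, is BIJECTIVE.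
[cite: Dieudonne1971GroupesClassiques, Chap. II §5] [cite: Liu2021, App. D §D.1 Step 3 (l. 5221)] -/
theorem bijective_abelianization_det_of_isCMField (w : PlacesOver L v) (hw : cc • w.1 = w.1)
    (hmem : ∀ g : (LemD1OfPlace.standingData L v cc N J (complexConj_imagUnit L) (imagUnit_ne_zero L) hN hJh hJdet).U,
      (Matrix.GeneralLinearGroup.det.comp
          (LemD1OfPlace.standingData L v cc N J (complexConj_imagUnit L) (imagUnit_ne_zero L) hN hJh hJdet).U.subtype) g ∈
        (LemD1OfPlace.standingData L v cc N J (complexConj_imagUnit L) (imagUnit_ne_zero L) hN hJh hJdet).normOne) :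
    Function.Bijective (Abelianization.lift
      ((Matrix.GeneralLinearGroup.det.comp
          (LemD1OfPlace.standingData L v cc N J (complexConj_imagUnit L) (imagUnit_ne_zero L) hN hJh hJdet).U.subtype).codRestrict
        (LemD1OfPlace.standingData L v cc N J (complexConj_imagUnit L) (imagUnit_ne_zero L) hN hJh hJdet).normOne hmem)) :=
  bijective_lift_of_commutator_eq _ (commutator_U_eq_ker_det_of_isCMField L v hN hN3 J hJh hJdet w hw) hmem fun k => by
    obtain ⟨g, hg⟩ := LemD1IndexedNonVacuityDetCarrier.exists_mem_U_det_eq L v cc (complexConj_imagUnit L) (imagUnit_ne_zero L) N J hN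
      hJh hJdet k
    exact ⟨g, by rw [MonoidHom.comp_apply, Subgroup.subtype_apply]; exact hg⟩

end CM

end Literature.NumberTheory.Automorphic.Liu2021.LemD1IndexedNonVacuityCharacterDecisionAllRanksAbelianization
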